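import Summits.Langlands.Langlands.Theses.SmithKummerSeed
import Summits.Langlands.Langlands.Theorems.IrreducibilityBySelfDualityReciprocityUpToIrreducibilityCorrespondsConj

/-!
# Birth skeleton (BC3) for crux stmt-Langlands-18649
`Summit.Langlands.Langlands.Theses.SmithKummerSeed.CyclicPrimeAscent` — line `birth`

Route `route-Langlands-SmithKummerSeed`; the crux is piece 1 of the crux-strategist split of
`AscentConjugationSolvable` (stmt-Langlands-1094; assembly proved in `Cruxes/AscentConjugationSolvable/Split.lean`):
for a Galois extension of number fields `L/K` of PRIME degree, full reciprocity for `GL_n` over `K` (both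
directions, every finite place, all `n`) implies full reciprocity over `L`.

This file concludes the crux BY NAME from two named stubs, cut along the DIRECTION seam, sharing the
reciprocity data:

* `stub_ascentAutToGal` (load-bearing, L) — direction (A) over `L` from reciprocity over `K`; it PRODUCES the
  data `R` for `L`: automorphic induction of `π′ ⊗ χ` to `K` (Arthur–Clozel Ch. 3 Thm 6.2, Henniart 2012),
  Galois representations over `K` in ALL weights (hypothesis), Clifford theory + de-induction over a separating
  family of twists (Taylor 1994 §3; the tree's `QuadraticWindow.TwistUnpackaging_proof` is the `p = 2` a.e.
  instance), local–global compatibility at every place of `L` transported from `K` through rec ∘ local base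
  change / automorphic induction (Arthur–Clozel Ch. 1 §6, Henniart–Herb 1995), de Rhamness by restriction,
  irreducibility and uniqueness by Chebotarev + Brauer–Nesbitt;
* `stub_ascentWeakGalToAut` (M–L) — WEAK direction (B) over `L` (a.e. Satake matching) for the same `R`, from
  reciprocity over `K` and (A) over `L`: `Ind_L^K ρ′` is semisimple geometric, its irreducible constituents are
  cuspidal-automorphic over `K` by (B) over `K`, their cyclic base changes to `L` (tree:
  `exists_baseChange_cyclic`) are isobaric sums of L-algebraic cuspidals, and (A) over `L` + Chebotarev /
  Brauer–Nesbitt + Clifford identify `ρ′` with the Galois representation of one constituent.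

The composition `CyclicPrimeAscent_of` is kernel-checked and sorry-free and is not a one-line seam: it takes
`R` from stub 1, weak (B) for that `R` from stub 2, and UPGRADES weak (B) to the summit's `GaloisToAutomorphic`
(local–global compatibility at every finite place) by the LANDED Chebotarev–Brauer–Nesbitt transport
`Theorems.ReciprocityUpToIrreducibility.corresponds_of_exists_corresponds` — packaged as the sorry-free lemma
`galoisToAutomorphic_of_weak` (verbatim the body of item stmt-Langlands-1065 `LiftDescend.WeakToStrongGalToAut`;
same lemma as in `Cruxes/ReciprocityTRCM/Lines/birth.lean`).

Shape (for `ledger skeleton check`): each stub is `theorem stub_<name> : <Prop> := by sorry` (closed statements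
over existing declarations only); `_Goal.stub_<name> : Prop := type_of% @stub_<name>`;
`CyclicPrimeAscent_of (h₁ : _Goal.stub_ascentAutToGal) (h₂ : _Goal.stub_ascentWeakGalToAut) : CyclicPrimeAscent`
concludes the route decl BY NAME; the last `example` feeds the stubs to it.

Disproof used: none exists — `ledger crux ls stmt-Langlands-1094` lists only `Split.lean`; the crux was born
2026-08-17 and is a consequence of the summit (`fun hS K L … => hS L`), so no `_false_without_H` with `H` short
of `¬Langlands` can exist. BC3 probes (stub → crux, stub → summit): failed 6/6 (strategist folder
bc/CyclicPrimeAscent_stub_probes.lean, rc 1). Sources: [ArthurClozelAMS120] Ch. 3 Thms 4.2/5.1/6.2, [Henniart2012],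
[HenniartHerb1995], [Taylor1994] §3, [Mok2014] §5, [Clifford1937].
-/

set_option linter.dupNamespace false

noncomputable section

namespace Summit.Langlands.Langlands.Cruxes.CyclicPrimeAscent.Birth

open Summit.Langlands.Langlands.Theses.SmithKummerSeed
open Filter

/-! ## 1. The two stubs -/

/-- **STUB 1 — direction (A) ascends along a Galois layer of prime degree** (load-bearing).  For `L/K` Galois
of prime degree and full reciprocity over `K`, there are reciprocity data `R` for `L` such that every
L-algebraic cuspidal `π′` of `GL_n(𝔸_L)`, `n ≥ 1`, has for all `ℓ`, `ι` an irreducible geometric `ρ_{π′,ι}`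
corresponding to it at every finite place, unique up to conjugacy (automorphic induction to `K`, Clifford
theory, de-induction over twists, local–global compatibility transported from `K`). Why it might fail as typed:
the `∃R` witness over `K` may be exotic local data, so rec-compatibility with local base change is not available
in tree without Henniart's ε-of-pairs characterisation.
[cite: ArthurClozelAMS120, Ch. 3 Thm. 6.2] [cite: Taylor1994, §3] [cite: HenniartHerb1995, Thm. 1] -/
theorem stub_ascentAutToGal : ∀ (K L : Type) [Field K] [NumberField K] [Field L] [NumberField L] [Algebra K L] [IsGalois K L], (Module.finrank K L).Prime → (∃ R : ReciprocityData K, ∀ n : ℕ, 0 < n → ∀ hcpt : Literature.NumberTheory.Automorphic.isCompact_glFiniteIntegralLevel n K, GlobalLanglandsCorrespondenceGLn n K R hcpt) → ∃ R : ReciprocityData L, ∀ n : ℕ, 0 < n → ∀ hcpt : Literature.NumberTheory.Automorphic.isCompact_glFiniteIntegralLevel n L, AutomorphicToGalois n R hcpt := by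
  sorry

/-- **STUB 2 — weak direction (B) over `L`, given reciprocity over `K` and (A) over `L` for the same data**:
for `L/K` Galois of prime degree, reciprocity data `R` for `L` carrying direction (A) in every rank, and full
reciprocity over `K`, every irreducible `R`-geometric `ρ′ : Γ_L → GL_n(ℚ̄_ℓ)` is Satake–Frobenius compatible at
almost all places with some L-algebraic cuspidal `π′` of `GL_n(𝔸_L)` (induce to `K`, (B) over `K`, cyclic base
change back, identify through (A) over `L`). Local–global compatibility is NOT asked here: it is recovered in
`galoisToAutomorphic_of_weak`. [cite: ArthurClozelAMS120, Ch. 3 Thm. 4.2 and Thm. 5.1] [cite: Clifford1937, Thm. 1] -/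
theorem stub_ascentWeakGalToAut : ∀ (K L : Type) [Field K] [NumberField K] [Field L] [NumberField L] [Algebra K L] [IsGalois K L] (R : ReciprocityData L), (Module.finrank K L).Prime → (∃ R₀ : ReciprocityData K, ∀ n : ℕ, 0 < n → ∀ hcpt : Literature.NumberTheory.Automorphic.isCompact_glFiniteIntegralLevel n K, GlobalLanglandsCorrespondenceGLn n K R₀ hcpt) → (∀ n : ℕ, 0 < n → ∀ hcpt : Literature.NumberTheory.Automorphic.isCompact_glFiniteIntegralLevel n L, AutomorphicToGalois n R hcpt) → ∀ (n : ℕ), 0 < n → ∀ (ℓ : ℕ) [Fact ℓ.Prime] (ι : PadicAlgCl ℓ ≃+* ℂ) (ρ : Literature.NumberTheory.GaloisRepresentations.FramedGaloisRep L (PadicAlgCl ℓ) n), ρ.toGaloisRep.IsIrreducible → IsGeometricFramed R ρ → ∀ hcpt : Literature.NumberTheory.Automorphic.isCompact_glFiniteIntegralLevel n L, ∃ π : Literature.NumberTheory.Automorphic.CuspidalAutomorphicRepData n L hcpt, π.1.IsLAlgebraic ∧ ∀ᶠ v : IsDedekindDomain.HeightOneSpectrum (NumberField.RingOfIntegers L)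 in cofinite, SatakeFrobCompatibleAt ι π.1 ρ v := by
  sorry

/-! ## 2. The stub statements as named propositions (the composition's hypotheses, by name) -/

namespace _Goal

/-- The statement of `stub_ascentAutToGal`, as a named `Prop` (literally its type). [folklore] -/
def stub_ascentAutToGal : Prop :=
  type_of% @Summit.Langlands.Langlands.Cruxes.CyclicPrimeAscent.Birth.stub_ascentAutToGal

/-- The statement of `stub_ascentWeakGalToAut`, as a named `Prop` (literally its type). [folklore] -/
def stub_ascentWeakGalToAut : Prop :=
  type_of% @Summit.Langlands.Langlands.Cruxes.CyclicPrimeAscent.Birth.stub_ascentWeakGalToAut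

end _Goal

/-! ## 3. Weak ⇒ strong (B), a theorem of the tree (Chebotarev + Brauer–Nesbitt transport) -/

/-- **Weak-to-strong upgrade of direction (B), for the same reciprocity data** (verbatim the body of item
stmt-Langlands-1065 `LiftDescend.WeakToStrongGalToAut`, here PROVED, as in `Cruxes/ReciprocityTRCM/Lines/birth.lean`):
if (A) holds for `𝓡` in every rank and every irreducible geometric `ρ` is Satake–Frobenius compatible a.e. with
some L-algebraic cuspidal `π`, then (B) holds for `𝓡`: (A) gives some `ρ'` corresponding to that `π` at every
finite place, `ρ'` and `ρ` are two avatars of `π` with `ρ` irreducible, hence conjugate, and `Corresponds`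
descends to conjugacy classes (`corresponds_of_exists_corresponds`, landed, sorry-free).
[cite: DeligneSerreASENS1974, Lemme 3.2] [cite: BuzzardGeeLMS2014, Conj. 3.2.2] -/
theorem galoisToAutomorphic_of_weak (F : Type) [Field F] [NumberField F] (R : ReciprocityData F)
    (hA : ∀ n : ℕ, 0 < n →
      ∀ hcpt : Literature.NumberTheory.Automorphic.isCompact_glFiniteIntegralLevel n F,
        AutomorphicToGalois n R hcpt)
    (hW : ∀ (n : ℕ), 0 < n → ∀ (ℓ : ℕ) [Fact ℓ.Prime] (ι : PadicAlgCl ℓ ≃+* ℂ)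
      (ρ : Literature.NumberTheory.GaloisRepresentations.FramedGaloisRep F (PadicAlgCl ℓ) n),
      ρ.toGaloisRep.IsIrreducible → IsGeometricFramed R ρ →
        ∀ hcpt : Literature.NumberTheory.Automorphic.isCompact_glFiniteIntegralLevel n F,
          ∃ π : Literature.NumberTheory.Automorphic.CuspidalAutomorphicRepData n F hcpt,
            π.1.IsLAlgebraic ∧
              ∀ᶠ v : IsDedekindDomain.HeightOneSpectrum (NumberField.RingOfIntegers F) in cofinite,
                SatakeFrobCompatibleAt ι π.1 ρ v) :
    ∀ n : ℕ, 0 < n →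
      ∀ hcpt : Literature.NumberTheory.Automorphic.isCompact_glFiniteIntegralLevel n F,
        GaloisToAutomorphic n R hcpt := by
  intro n hn hcpt ℓ _ ι ρ hirr hgeo
  obtain ⟨π, hL, hsat⟩ := hW n hn ℓ ι ρ hirr hgeo hcpt
  obtain ⟨ρ', -, -, hcorr', -⟩ := hA n hn hcpt π hL ℓ ι
  exact ⟨π, hL,
    Theorems.ReciprocityUpToIrreducibility.corresponds_of_exists_corresponds hirr hsat ⟨ρ', hcorr'⟩⟩

/-! ## 4. The composition (kernel-checked, no `sorry`): (A)_L with its data → weak (B)_L → crux by name -/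

/-- **`CyclicPrimeAscent` from the two stubs.** Given `L/K` Galois of prime degree and reciprocity over `K`:
`R` and (A) over `L` from stub 1; weak (B) for that `R` from stub 2; (B) with local–global compatibility
everywhere by `galoisToAutomorphic_of_weak`; so `GlobalLanglandsCorrespondenceGLn n L R hcpt = (A) ∧ (B)` for
every `n ≥ 1`. The hypotheses are, by name, the statements of `stub_ascentAutToGal`, `stub_ascentWeakGalToAut`;
the conclusion is the route decl. [folklore] -/
theorem CyclicPrimeAscent_of (h₁ : _Goal.stub_ascentAutToGal) (h₂ : _Goal.stub_ascentWeakGalToAut) :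
    CyclicPrimeAscent := by
  unfold _Goal.stub_ascentAutToGal at h₁
  unfold _Goal.stub_ascentWeakGalToAut at h₂
  intro K L _ _ _ _ _ _ hp hK
  obtain ⟨R, hAR⟩ := h₁ K L hp hK
  exact ⟨R, fun n hn hcpt =>
    ⟨hAR n hn hcpt, galoisToAutomorphic_of_weak L R hAR (h₂ K L R hp hK hAR) n hn hcpt⟩⟩

/-- By-name sanity check (an `example`, not a declaration of the file): the two stubs feed the composition
as they stand. -/
example : CyclicPrimeAscent := CyclicPrimeAscent_of stub_ascentAutToGal stub_ascentWeakGalToAut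

end Summit.Langlands.Langlands.Cruxes.CyclicPrimeAscent.Birth

end
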